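/-
Copyright (c) 2026. All rights reserved.
Released under Apache 2.0 license as described in the file LICENSE.
-/
import Summits.RiemannHypothesis.RiemannHypothesis.Theorems.Splittings.ScrewLatticeThinWall
import HarnessLib

/-!
# LINE L1 (THIN WALL) — by-name closers of the three SUPPORT items from the landed row X-10

The LINE L1 items registered on route `IntegerScrew` (stmt-RiemannHypothesis-21517 / 21518 / 21519) are
typed in the METRIC form `μH[1] (closure (aliasedPoleSet h) ∩ ball 0 1) = 0` (the tree predicate
`ScrewLatticeThinWall.ThinWall h` unfolds to it by `rfl`).  This file proves the three registered signatures
VERBATIM from the tree theorems of `Splittings/ScrewLatticeThinWall.lean` (row X-10, landed 2026-08-27):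
once the gate renders the decls `IntegerScrew.LatticeCeilingThinWallIffRH`, `.ThinWallOfCountableClosure`,
`.LatticeCeilingDichotomyLength`, each item closes by `theorem … : <Decl> := <the lemma below>`.
Nothing here bears on the truth of RH.
-/

set_option linter.dupNamespace false

namespace Summit.RiemannHypothesis.RiemannHypothesis.Theorems.Splittings.ScrewThinWallClosers

open Metric MeasureTheory
open scoped ENNReal
open Summit.RiemannHypothesis.RiemannHypothesis.Theorems.Splittings.ScrewLatticeContinuation
open Summit.RiemannHypothesis.RiemannHypothesis.Theorems.Splittings.ScrewLatticeThinWall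

/-- Closer for item `LatticeCeilingThinWallIffRH` (stmt-RiemannHypothesis-21517): row X-10 in metric form. -/
theorem latticeCeilingThinWallIffRH_sig :
    ∀ h : ℝ, 0 < h → ((LatticeCeiling h ∧
      MeasureTheory.Measure.hausdorffMeasure 1 (closure (aliasedPoleSet h) ∩ Metric.ball (0 : ℂ) 1) = 0) ↔
      _root_.RiemannHypothesis) :=
  fun _h hh ↦ latticeCeiling_and_thinWall_iff_rh hh

/-- Closer for item `ThinWallOfCountableClosure` (stmt-RiemannHypothesis-21518): the BC5 rung `CC(h) ⟹ TW(h)`. -/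
theorem thinWallOfCountableClosure_sig :
    ∀ h : ℝ, CountableClosure h →
      MeasureTheory.Measure.hausdorffMeasure 1 (closure (aliasedPoleSet h) ∩ Metric.ball (0 : ℂ) 1) = 0 :=
  fun _h hcc ↦ thinWall_of_countableClosure hcc

/-- Closer for item `LatticeCeilingDichotomyLength` (stmt-RiemannHypothesis-21519): the RH-free dichotomy. -/
theorem latticeCeilingDichotomyLength_sig :
    ∀ h : ℝ, 0 < h → LatticeCeiling h →
      (_root_.RiemannHypothesis ∨
        0 < MeasureTheory.Measure.hausdorffMeasure 1 (closure (aliasedPoleSet h) ∩ Metric.ball (0 : ℂ) 1)) :=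
  fun _h hh hceil ↦ latticeCeiling_dichotomy_length hh hceil

end Summit.RiemannHypothesis.RiemannHypothesis.Theorems.Splittings.ScrewThinWallClosers
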